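import Literature.Topology.FourManifolds.WildCollarFlapDeriv
import Mathlib.Analysis.SpecialFunctions.Complex.Arg
import Mathlib.Algebra.Order.ToIntervalMod
import HarnessLib

/-!
# The wild collar flap, III: injectivity, fibre bounds, and the punctured disc

Topic `Literature/Topology/FourManifolds`, concluding `WildCollarFlap.lean` and
`WildCollarFlapDeriv.lean` (the explicit flap `Φ (s, y) = (axial s y, fibre s y)` used to refute
the mis-stated slide lemma `FramedLink.IsStrictHandleSlide.slideDiffeoAligned`).

* `WildFlap.sz`, `WildFlap.sz_mem`, `WildFlap.le_sz_iff` — the turn-around time `s_z ∈ (2/100, 3/100)`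
  at which the radius of the slices starts to decrease for good (`χ (100 s_z - 2) = 1/2`);
* `WildFlap.crad_pos`, `WildFlap.crad_strictAntiOn` — the radius is positive on
  `(-3/100, 7/100)` and strictly decreasing on `[s_z, 7/100]`;
* `WildFlap.injOn_Φ` — **`Φ` is injective on `(-3/100, 7/100) × (-11/10, 1/10)`**: slices of
  the eras `N ∪ A ∪ W₁ = (-3/100, 2/100]` and `C = (s_z, 7/100)` are told apart by their radius,
  those of the turn-around `W₂ = (2/100, s_z]` by their axial drift, slices of `C` are beyond
  the honest axial range of the others, and inside one slice the direction angle (and, where a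
  slice closes up on itself, the tilt `υ`) separates the points;
* `WildFlap.fibre_ne_zero'`, `WildFlap.norm_fibre_le`, `WildFlap.fibre_fst_pos_or_axial_gt` —
  the fibre coordinate is nonzero, of norm `≤ 6/100`, and points either have positive first fibre
  coordinate or axial coordinate `> 1/10` (so the flap misses the band proper);
* `WildFlap.exists_Φ_eq` — **the flap covers the flat punctured disc** `{3/5} × {0 < ‖w‖ < 1/50}`.

Everything is proved; no named facts.
-/

noncomputable section

open Set Real Filter
open scoped ContDiff Topology

namespace Literature.Topology.FourManifolds

/-- Local notation: `𝔼 n` is the model Euclidean space `EuclideanSpace ℝ (Fin n)`. -/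
local notation "𝔼 " n:arg => EuclideanSpace ℝ (Fin n)

namespace WildFlap

/-- Shorthand for Mathlib's smooth transition `χ`. [folklore] -/
local notation "χ" => Real.smoothTransition

/-! ## The turn-around time `s_z` -/

/-- There is a time in `(2/100, 3/100)` at which `χ (100 s - 2) = 1/2`. [folklore] -/
theorem exists_sz : ∃ z ∈ Ioo (2 / 100 : ℝ) (3 / 100), χ (100 * z - 2) = 1 / 2 := by
  have hc : ContinuousOn (fun s : ℝ ↦ χ (100 * s - 2)) (Icc (2 / 100) (3 / 100)) :=
    (contDiff_χ_affine 100 2).continuous.continuousOn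
  have h23 : (2 / 100 : ℝ) ≤ 3 / 100 := by norm_num
  have h0 : χ (100 * (2 / 100 : ℝ) - 2) = 0 := by norm_num [Real.smoothTransition.zero]
  have h1 : χ (100 * (3 / 100 : ℝ) - 2) = 1 := by norm_num [Real.smoothTransition.one]
  obtain ⟨z, hz, hzv⟩ := intermediate_value_Icc h23 hc
    (show (1 / 2 : ℝ) ∈ Icc (χ (100 * (2 / 100 : ℝ) - 2)) (χ (100 * (3 / 100 : ℝ) - 2)) by
      rw [h0, h1]; norm_num)
  simp only at hzv
  refine ⟨z, ⟨lt_of_le_of_ne hz.1 ?_, lt_of_le_of_ne hz.2 ?_⟩, hzv⟩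
  · rintro rfl; rw [h0] at hzv; norm_num at hzv
  · rintro rfl; rw [h1] at hzv; norm_num at hzv

/-- **The turn-around time** `s_z ∈ (2/100, 3/100)`, `χ (100 s_z - 2) = 1/2`. [folklore] -/
def sz : ℝ := exists_sz.choose

/-- `sz_mem`: an elementary bound or non-vanishing for the explicit construction (see the module docstring). [folklore] -/
theorem sz_mem : sz ∈ Ioo (2 / 100 : ℝ) (3 / 100) := exists_sz.choose_spec.1

/-- `χ_sz`: an elementary property of the explicit construction (see the module docstring). [folklore] -/
theorem χ_sz : χ (100 * sz - 2) = 1 / 2 := exists_sz.choose_spec.2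

/-- `χ (100 s - 2) ≤ 1/2` iff `s ≤ s_z`. [folklore] -/
theorem χ_le_half_iff {s : ℝ} : χ (100 * s - 2) ≤ 1 / 2 ↔ s ≤ sz := by
  constructor
  · intro h
    by_contra hlt
    rw [not_le] at hlt
    have := χ_lt_of_lt (show 100 * sz - 2 < 100 * s - 2 by linarith)
      (by linarith [sz_mem.2]) (by linarith [sz_mem.1])
    rw [χ_sz] at this
    linarith
  · intro h
    rw [← χ_sz]
    exact Real.smoothTransition.monotone (by linarith)

/-- `θh_sz`: an elementary property of the explicit construction (see the module docstring). [folklore] -/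
theorem θh_sz : θh sz = 1 / 4 := by
  rw [θh, χ_sz]; norm_num

/-- Beyond the turn-around the axial drift is at least `1/4`. [folklore] -/
theorem θh_ge_of_sz_lt {s : ℝ} (hs : sz < s) : 1 / 4 ≤ θh s := by
  rw [← θh_sz]; exact θh_mono hs.le

/-! ## The radius on the parameter domain -/

/-- **The radius is positive** on `(-3/100, 7/100)`. [folklore] -/
theorem crad_pos {s : ℝ} (hs : s ∈ Ioo (-(3 / 100) : ℝ) (7 / 100)) : 0 < crad s := by
  rcases le_or_gt s (2 / 100) with h | h
  · rw [crad_of_le h]; linarith [hs.1]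
  rcases le_or_gt (3 / 100) s with h' | h'
  · rw [crad_of_ge h']; linarith [hs.2]
  · rw [crad_eq]
    have h1 := Real.smoothTransition.nonneg (100 * s - 2)
    have h2 := Real.smoothTransition.le_one (100 * s - 2)
    nlinarith

/-- On the turn-around `(2/100, s_z]` the radius is at least `5/100`. [folklore] -/
theorem crad_ge_of_le_sz {s : ℝ} (hs : 2 / 100 < s) (hs' : s ≤ sz) : 5 / 100 ≤ crad s :=
  (crad_ge_iff hs).2 (χ_le_half_iff.2 hs')

/-- Beyond the turn-around the radius is below `5/100`. [folklore] -/
theorem crad_lt_of_sz_lt {s : ℝ} (hs : sz < s) : crad s < 5 / 100 := by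
  rcases le_or_gt (3 / 100) s with h | h
  · rw [crad_of_ge h]; linarith
  · exact (crad_lt_iff (sz_mem.1.trans hs)).2 (not_le.1 fun h' ↦ (χ_le_half_iff.1 h').not_gt hs)

/-- Beyond the turn-around the radius has negative derivative. [folklore] -/
theorem deriv_crad_neg_of_sz_lt {s : ℝ} (hs : sz < s) : deriv crad s < 0 := by
  rcases le_or_gt (3 / 100) s with h | h
  · rw [deriv_crad_of_ge h]; norm_num
  · exact deriv_crad_neg ⟨sz_mem.1.trans hs, h⟩
      (not_le.1 fun h' ↦ (χ_le_half_iff.1 h').not_gt hs)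

/-- **The radius is strictly decreasing on `[s_z, 7/100]`.** [folklore] -/
theorem crad_strictAntiOn : StrictAntiOn crad (Icc sz (7 / 100)) := by
  refine strictAntiOn_of_deriv_neg (convex_Icc _ _) contDiff_crad.continuous.continuousOn ?_
  intro s hs
  rw [interior_Icc] at hs
  exact deriv_crad_neg_of_sz_lt hs.1

/-! ## The fibre on the parameter domain -/

/-- Every planar vector is `vec` of its coordinates. [folklore] -/
theorem vec_apply_eq (w : 𝔼 2) : vec (w 0) (w 1) = w := by
  ext i; fin_cases i <;> simp

/-- **The fibre coordinate does not vanish** on `(-3/100, 7/100)`: the flap misses the strand.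
[folklore] -/
theorem fibre_ne_zero' {s : ℝ} (hs : s ∈ Ioo (-(3 / 100) : ℝ) (7 / 100)) (y : ℝ) :
    fibre s y ≠ 0 :=
  fibre_ne_zero (crad_pos hs).ne' y

/-- **The fibre stays within radius `6/100`** on `(-3/100, 7/100)`. [folklore] -/
theorem norm_fibre_le {s : ℝ} (hs : s ∈ Ioo (-(3 / 100) : ℝ) (7 / 100)) (y : ℝ) :
    ‖fibre s y‖ ≤ 6 / 100 := by
  rw [norm_fibre, abs_of_pos (crad_pos hs)]; exact crad_le s

/-- Points of the flap either have **positive first fibre coordinate** (up to the turn-around,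
directions stay in the open quarter plane) or **axial coordinate beyond `1/10`** (after it).
[folklore] -/
theorem fibre_fst_pos_or_axial_gt {s y : ℝ} (hs : s ∈ Ioo (-(3 / 100) : ℝ) (7 / 100))
    (hy : y ∈ Ioo (-(11 / 10) : ℝ) (1 / 10)) : 0 < fibre s y 0 ∨ 1 / 10 < axial s y := by
  rcases le_or_gt s sz with h | h
  · left
    rw [fibre_apply_zero]
    refine mul_pos (crad_pos hs) (Real.cos_pos_of_mem_Ioo ⟨?_, ?_⟩)
    · linarith [ang_nonneg s hy.1, pi_pos]
    · exact ang_lt_pi_div_two (h.trans sz_mem.2.le) hy.1 hy.2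
  · right
    have h1 := axial_ge (by linarith [sz_mem.1] : 1 / 100 ≤ s) hy.1
    have h2 := θh_ge_of_sz_lt h
    linarith

/-! ## Injectivity -/

/-- Equal fibres have equal radii. [folklore] -/
theorem crad_eq_of_fibre_eq {s s' y y' : ℝ} (hs : s ∈ Ioo (-(3 / 100) : ℝ) (7 / 100))
    (hs' : s' ∈ Ioo (-(3 / 100) : ℝ) (7 / 100)) (h : fibre s y = fibre s' y') :
    crad s = crad s' := by
  have := congrArg (‖·‖) h
  simp only [norm_fibre, abs_of_pos (crad_pos hs), abs_of_pos (crad_pos hs')] at this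
  exact this

/-- Equal fibres on one slice have direction angles differing by a multiple of `2π`. [folklore] -/
theorem exists_int_of_fibre_eq {s y y' : ℝ} (hs : s ∈ Ioo (-(3 / 100) : ℝ) (7 / 100))
    (h : fibre s y = fibre s y') : ∃ k : ℤ, ang s y' = ang s y + k * (2 * π) :=
  exists_int_of_vec_polar_eq (crad_pos hs).ne' h

/-- Inside one slice, equal fibre and axial coordinates are impossible for `y < y'`. [folklore] -/
theorem same_slice_aux {s y y' : ℝ} (hs : s ∈ Ioo (-(3 / 100) : ℝ) (7 / 100))
    (hy : y ∈ Ioo (-(11 / 10) : ℝ) (1 / 10)) (hy' : y' ∈ Ioo (-(11 / 10) : ℝ) (1 / 10))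
    (hw : fibre s y = fibre s y') (hX : axial s y = axial s y') (hlt : y < y') : False := by
  rcases le_or_gt s (1 / 100) with h1 | h1
  · -- axial era: `axial = Λ s · y` with `Λ s > 0`
    rw [axial_of_le' h1, axial_of_le' h1] at hX
    have hΛ : 0 < Λ s := Λ_pos (by linarith)
    have := mul_lt_mul_of_pos_left hlt hΛ
    linarith
  · obtain ⟨k, hk⟩ := exists_int_of_fibre_eq hs hw
    have hsin : 0 < Real.sin (ψ s) := sin_ψ_pos h1
    have h2π1 := two_pi_add_one_pos
    have hmono : ang s y < ang s y' := by
      simp only [ang]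
      exact mul_lt_mul_of_pos_left (σ_strictMono hlt) (mul_pos hsin h2π1)
    have hk0 : 0 ≤ ang s y := ang_nonneg s hy.1
    have hk1 : ang s y' < 2 * π + 1 := ang_lt s hy'.1 hy'.2
    -- `k = 1`
    have hkpos : (0 : ℝ) < k := by
      have : (0 : ℝ) < k * (2 * π) := by linarith
      exact pos_of_mul_pos_left this (by positivity)
    have hk2 : (k : ℝ) < 2 := by
      have h3 : (3 : ℝ) < π := Real.pi_gt_three
      by_contra hk2
      rw [not_lt] at hk2
      have : (2 : ℝ) * (2 * π) ≤ k * (2 * π) := by nlinarith [pi_pos]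
      linarith
    have hk1' : k = 1 := by
      have h0 : (0 : ℤ) < k := by exact_mod_cast hkpos
      have h2 : k < 2 := by exact_mod_cast hk2
      omega
    rw [hk1', Int.cast_one, one_mul] at hk
    -- the slice closes up: `sin ψ (2π + 1) (σ y' - σ y) = 2π`
    have hdiff : Real.sin (ψ s) * (2 * π + 1) * (σ y' - σ y) = 2 * π := by
      have : ang s y' - ang s y = 2 * π := by linarith
      simp only [ang] at this
      linarith
    -- and then the axial coordinates differ
    have hυ : υ y ≤ υ y' := υ_mono hlt.le
    have hX' : axial s y' - axial s y =
        Λ s * (y' - y) + 1 / 10 * Real.sin (ψ s) * (υ y' - υ y) := by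
      simp only [axial]; ring
    rcases (Λ_nonneg s).lt_or_eq with hΛ | hΛ
    · have : 0 < axial s y' - axial s y := by
        rw [hX']
        have := mul_pos hΛ (sub_pos.2 hlt)
        nlinarith
      linarith
    · -- `Λ s = 0`: `s ≥ 5/100`, `sin ψ = 1`, and the tilt separates the two sheets
      have hs5 : 5 / 100 ≤ s := by
        by_contra h5
        exact (Λ_pos (not_le.1 h5)).ne' hΛ.symm
      have hsin1 : Real.sin (ψ s) = 1 := sin_ψ_of_ge (by linarith)
      rw [hsin1, one_mul] at hdiff
      have hσy' : σ y' < 1 := σ_lt_one hy'.2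
      have hσy : σ y < σ ystar := by
        rw [σ_ystar, lt_div_iff₀ h2π1]
        nlinarith
      have hσy'2 : σ ystar < σ y' := by
        rw [σ_ystar, div_lt_iff₀ h2π1]
        have h3 : (3 : ℝ) < π := Real.pi_gt_three
        have : 0 < σ y := σ_pos hy.1
        nlinarith
      have hyst : y < ystar := σ_strictMono.lt_iff_lt.1 hσy
      have hyst' : ystar < y' := σ_strictMono.lt_iff_lt.1 hσy'2
      have hυy : υ y < 1 := υ_lt_one hyst
      have hυy' : υ y' = 1 := υ_of_ge hyst'.le
      have : 0 < axial s y' - axial s y := by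
        rw [hX', ← hΛ, hsin1, hυy']
        linarith
      linarith

/-- Inside one slice, **equal fibre and axial coordinates force equal positions.** [folklore] -/
theorem eq_of_same_slice {s y y' : ℝ} (hs : s ∈ Ioo (-(3 / 100) : ℝ) (7 / 100))
    (hy : y ∈ Ioo (-(11 / 10) : ℝ) (1 / 10)) (hy' : y' ∈ Ioo (-(11 / 10) : ℝ) (1 / 10))
    (hw : fibre s y = fibre s y') (hX : axial s y = axial s y') : y = y' := by
  rcases lt_trichotomy y y' with hlt | heq | hgt
  · exact (same_slice_aux hs hy hy' hw hX hlt).elim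
  · exact heq
  · exact (same_slice_aux hs hy' hy hw.symm hX.symm hgt).elim

/-- **The flap is injective on `(-3/100, 7/100) × (-11/10, 1/10)`.** [folklore] -/
theorem injOn_Φ : InjOn Φ (Ioo (-(3 / 100) : ℝ) (7 / 100) ×ˢ Ioo (-(11 / 10) : ℝ) (1 / 10)) := by
  -- it suffices to treat pairs with `s ≤ s'`
  suffices key : ∀ s y s' y', s ≤ s' → s ∈ Ioo (-(3 / 100) : ℝ) (7 / 100) →
      s' ∈ Ioo (-(3 / 100) : ℝ) (7 / 100) → y ∈ Ioo (-(11 / 10) : ℝ) (1 / 10) →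
      y' ∈ Ioo (-(11 / 10) : ℝ) (1 / 10) → Φ (s, y) = Φ (s', y') → (s, y) = (s', y') by
    rintro ⟨s, y⟩ ⟨hs, hy⟩ ⟨s', y'⟩ ⟨hs', hy'⟩ h
    rcases le_total s s' with hss | hss
    · exact key s y s' y' hss hs hs' hy hy' h
    · exact (key s' y' s y hss hs' hs hy' hy h.symm).symm
  intro s y s' y' hss hs hs' hy hy' h
  have hX : axial s y = axial s' y' := congrArg Prod.fst h
  have hw : fibre s y = fibre s' y' := congrArg Prod.snd h
  have hc : crad s = crad s' := crad_eq_of_fibre_eq hs hs' hw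
  -- first `s = s'`, then `y = y'` inside the slice
  suffices hss' : s = s' by
    subst hss'
    rw [eq_of_same_slice hs hy hy' hw hX]
  rcases le_or_gt s' (2 / 100) with h2 | h2
  · -- both radii are `3/100 + s`
    rw [crad_of_le (hss.trans h2), crad_of_le h2] at hc
    linarith
  rcases le_or_gt s' sz with hz | hz
  · -- `s'` on the turn-around: radius `≥ 5/100`, so `s ≥ 3/200`, both turning angles are `ψ₀`,
    -- directions agree, positions agree, and the axial drift tells the times apart
    have hc' : 5 / 100 ≤ crad s' := crad_ge_of_le_sz h2 hz
    have hs32 : 3 / 200 ≤ s := by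
      by_contra hlt
      rw [not_le] at hlt
      rw [crad_of_le (by linarith : s ≤ 2 / 100)] at hc
      linarith
    have hψs : ψ s = ψ₀ := ψ_of_mem ⟨hs32, by linarith [sz_mem.2]⟩
    have hψs' : ψ s' = ψ₀ := ψ_of_mem ⟨by linarith, by linarith [sz_mem.2]⟩
    have hΛs : Λ s = 1 / 10 := Λ_of_mem ⟨by linarith, by linarith [sz_mem.2]⟩
    have hΛs' : Λ s' = 1 / 10 := Λ_of_mem ⟨by linarith, by linarith [sz_mem.2]⟩
    -- directions agree
    have hang : ang s y = ang s' y' := by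
      have hw2 : fibre s' y = fibre s' y' := by
        have : fibre s y = fibre s' y := by
          simp only [fibre, ang, hψs, hψs', hc]
        rw [← this]; exact hw
      obtain ⟨k, hk⟩ := exists_int_of_fibre_eq hs' hw2
      have h0 : 0 ≤ ang s' y := ang_nonneg s' hy.1
      have h0' : 0 ≤ ang s' y' := ang_nonneg s' hy'.1
      have h1 : ang s' y < π / 2 := ang_lt_pi_div_two (hz.trans sz_mem.2.le) hy.1 hy.2
      have h1' : ang s' y' < π / 2 := ang_lt_pi_div_two (hz.trans sz_mem.2.le) hy'.1 hy'.2
      have hk0 : k = 0 := by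
        have hlt1 : (k : ℝ) < 1 := by
          by_contra hk; rw [not_lt] at hk
          have : (1 : ℝ) * (2 * π) ≤ k * (2 * π) := by nlinarith [pi_pos]
          linarith [pi_pos]
        have hgt1 : (-1 : ℝ) < k := by
          by_contra hk; rw [not_lt] at hk
          have : (k : ℝ) * (2 * π) ≤ -1 * (2 * π) := by nlinarith [pi_pos]
          linarith [pi_pos]
        have : (-1 : ℤ) < k := by exact_mod_cast hgt1
        have : k < 1 := by exact_mod_cast hlt1
        omega
      rw [hk0, Int.cast_zero, zero_mul, add_zero] at hk
      have : ang s y = ang s' y := by simp only [ang, hψs, hψs']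
      rw [this, hk]
    have hyy : y = y' := by
      simp only [ang, hψs, hψs', sin_ψ₀] at hang
      have h2π1 := two_pi_add_one_pos
      have : σ y = σ y' := by nlinarith
      exact σ_injective this
    subst hyy
    -- the axial drift tells the times apart
    have hθ : θh s = θh s' := by
      simp only [axial, hψs, hψs', hΛs, hΛs'] at hX
      linarith
    by_contra hne
    have hlt : s < s' := lt_of_le_of_ne hss hne
    exact (θh_lt_θh hlt (by linarith [sz_mem.2]) h2).ne hθ
  · -- `s'` beyond the turn-around
    rcases le_or_gt s sz with hz' | hz'
    · exfalso
      rcases le_or_gt s (2 / 100) with h2' | h2'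
      · -- axial coordinates are apart
        have hXle : axial s y ≤ 11 / 100 := by
          rcases le_or_gt s (1 / 100) with h1 | h1
          · rw [axial_of_le' h1]
            have := Λ_nonneg s; have := Λ_le_one s
            rcases le_or_gt 0 y with hy0 | hy0
            · nlinarith [hy.2]
            · nlinarith [hy.2]
          · have := axial_le h1.le hy.2
            rw [θh_of_le h2'] at this
            linarith
        have hXge : 14 / 100 ≤ axial s' y' := by
          have h1 := axial_ge (by linarith [sz_mem.1] : 1 / 100 ≤ s') hy'.1
          have h2 := θh_ge_of_sz_lt hz
          linarith
        linarith
      · -- radii are apart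
        have := crad_ge_of_le_sz h2' hz'
        have := crad_lt_of_sz_lt hz
        linarith
    · -- both beyond: the radius is strictly decreasing
      exact crad_strictAntiOn.injOn ⟨hz'.le, hs.2.le⟩ ⟨hz.le, hs'.2.le⟩ hc

/-! ## The punctured disc -/

/-- **The flap covers the flat punctured disc** `{3/5} × {0 < ‖w‖ < 1/50}`: every such `(3/5, w)`
is `Φ (s, y)` with `s = 7/100 - ‖w‖ ∈ (5/100, 7/100)` and some `y ∈ [y⋆, 1/10)`. [folklore] -/
theorem exists_Φ_eq {w : 𝔼 2} (h0 : w ≠ 0) (hw : ‖w‖ < 1 / 50) :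
    ∃ s ∈ Ioo (5 / 100 : ℝ) (7 / 100), ∃ y ∈ Ico ystar (1 / 10), Φ (s, y) = (3 / 5, w) := by
  set r : ℝ := ‖w‖ with hr
  have hr0 : 0 < r := norm_pos_iff.2 h0
  set s : ℝ := 7 / 100 - r with hs
  have hs5 : 5 / 100 < s := by rw [hs]; linarith
  have hs7 : s < 7 / 100 := by rw [hs]; linarith
  have hcr : crad s = r := by rw [crad_of_ge (by linarith), hs]; ring
  -- polar angle of `w`, moved into `[1, 1 + 2π)`
  set z : ℂ := ⟨w 0, w 1⟩ with hz
  have hzn : ‖z‖ = r := by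
    rw [hr, EuclideanSpace.norm_eq, Fin.sum_univ_two, Complex.norm_def, Complex.normSq_mk]
    congr 1
    simp [sq]
  set t : ℝ := toIcoMod two_pi_pos 1 (Complex.arg z) with ht
  have htmem : t ∈ Ico (1 : ℝ) (1 + 2 * π) := toIcoMod_mem_Ico two_pi_pos 1 _
  have hcos : Real.cos t = Real.cos (Complex.arg z) := by
    rw [ht, toIcoMod, zsmul_eq_mul]
    rw [show Complex.arg z - (toIcoDiv two_pi_pos 1 (Complex.arg z) : ℝ) * (2 * π) =
      Complex.arg z - (toIcoDiv two_pi_pos 1 (Complex.arg z) : ℤ) * (2 * π) by norm_cast]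
    exact Real.cos_sub_int_mul_two_pi _ _
  have hsin : Real.sin t = Real.sin (Complex.arg z) := by
    rw [ht, toIcoMod, zsmul_eq_mul]
    rw [show Complex.arg z - (toIcoDiv two_pi_pos 1 (Complex.arg z) : ℝ) * (2 * π) =
      Complex.arg z - (toIcoDiv two_pi_pos 1 (Complex.arg z) : ℤ) * (2 * π) by norm_cast]
    exact Real.sin_sub_int_mul_two_pi _ _
  have hw0 : r * Real.cos t = w 0 := by
    rw [hcos, ← hzn, Complex.norm_mul_cos_arg]
  have hw1 : r * Real.sin t = w 1 := by
    rw [hsin, ← hzn, Complex.norm_mul_sin_arg]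
  -- the position along the slice
  set y : ℝ := -(11 / 10) + 6 / 5 * (t / (2 * π + 1)) with hy
  have h2π1 := two_pi_add_one_pos
  have hσy : σ y = t / (2 * π + 1) := by rw [hy]; simp only [σ]; ring
  have hyst : ystar ≤ y := by
    have : σ ystar ≤ σ y := by
      rw [σ_ystar, hσy]
      exact div_le_div_of_nonneg_right htmem.1 h2π1.le
    exact σ_strictMono.le_iff_le.1 this
  have hy10 : y < 1 / 10 := by
    have : σ y < 1 := by
      rw [hσy, div_lt_one h2π1]; linarith [htmem.2]
    simp only [σ] at this
    linarith
  refine ⟨s, ⟨hs5, hs7⟩, y, ⟨hyst, hy10⟩, ?_⟩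
  have hang : ang s y = t := by
    rw [ang_of_ge (by linarith), hσy]
    field_simp
  rw [Φ]
  congr 1
  · change axial s y = 3 / 5
    rw [axial, θh_of_ge (by linarith), Λ_of_ge (by linarith), sin_ψ_of_ge (by linarith),
      υ_of_ge hyst]
    norm_num
  · change fibre s y = w
    rw [fibre, hang, hcr, hw0, hw1, vec_apply_eq]

end WildFlap

end Literature.Topology.FourManifolds
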